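import Literature.NumberTheory.CubicFields.PureCubicLatticeHNFCanon
import Mathlib.NumberTheory.NumberField.Basic
import Mathlib.RingTheory.Norm.Basic
import Mathlib.Tactic.FieldSimp
import Mathlib.Tactic.LinearCombination
import HarnessLib

/-!
# Codes of elements and lattices of a pure cubic field: semantics in the field

Topic `NumberTheory/CubicFields`; theorem-only sequel of `PureCubicLatticeCodes.lean`,
`PureCubicLatticeHNF.lean`, `PureCubicLatticeHNFCanon.lean`. Here the rows are read in a field `K`
through `lin θ b (x, y, z) = x + yθ + zθ₂`, `θ₂ = θ²/b`:

* `lin_combo3`, `lin_scaleRow`, **`lin_mulRow`** — `lin` is additive and, when `θ³ = ab²`,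
  multiplicative for the row product `mulRow` (the multiplication table `θ² = bθ₂`, `θ₂² = aθ`,
  `θθ₂ = ab` of Dedekind's basis);
* `mem_iff_rowSpan` — the member set `Mem θ b c` of a six-entry code is `(1/den) · lin (rowSpan)`;
  **`mem_latOfGens_iff`** — the member set of `latOfGens D gens` is `(1/D) · lin (ℤ-span of gens)`;
* `mulE_spec`, `normE_spec` — the product and norm programs on element codes are correct
  (the latter given the norm form `x³ + ab²y³ + a²bz³ − 3abxyz` on `ℚ`-coordinates);
* `lin_injective`, `dvd_of_mem_imp`, `rowSpan_le_of_mem_imp`, **`canon_unique`** — given the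
  `ℚ`-independence of `(1, θ, θ₂)`, canonical codes with the same member set are equal
  (the denominator is the least one by the gcd condition; then HNF uniqueness).

## References

* H. Cohen, *A Course in Computational Algebraic Number Theory*, GTM 138, Springer 1993, §4.7.1
  (HNF representation of modules, uniqueness), §6.4.5 (pure cubic fields). [Cohen1993]
-/

namespace Literature.NumberTheory.CubicFields

namespace PureCubicCodes

variable {K : Type*} [Field K]

/-! ### The coordinate map -/

/-- `lin` on a three-term integer combination. [folklore] -/
theorem lin_combo3 (θ : K) (b : ℕ) (u v w : ℤ) (p q r : Row) :
    lin θ b (u * p.1 + v * q.1 + w * r.1, u * p.2.1 + v * q.2.1 + w * r.2.1, u * p.2.2 + v * q.2.2 + w * r.2.2) =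
      (u : K) * lin θ b p + (v : K) * lin θ b q + (w : K) * lin θ b r := by
  simp only [lin]; push_cast; ring

/-- `lin` on a four-term integer combination. [folklore] -/
theorem lin_combo4 (θ : K) (b : ℕ) (u v w k : ℤ) (p q r g : Row) :
    lin θ b (u * p.1 + v * q.1 + w * r.1 + k * g.1, u * p.2.1 + v * q.2.1 + w * r.2.1 + k * g.2.1,
        u * p.2.2 + v * q.2.2 + w * r.2.2 + k * g.2.2) =
      (u : K) * lin θ b p + (v : K) * lin θ b q + (w : K) * lin θ b r + (k : K) * lin θ b g := by
  simp only [lin]; push_cast; ring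

/-- `lin` commutes with scalars. [folklore] -/
theorem lin_scaleRow (θ : K) (b : ℕ) (k : ℤ) (p : Row) : lin θ b (scaleRow k p) = (k : K) * lin θ b p := by
  simp only [lin, scaleRow]; push_cast; ring

/-- `lin` is additive. [folklore] -/
theorem lin_add (θ : K) (b : ℕ) (p q : Row) : lin θ b (p + q) = lin θ b p + lin θ b q := by
  simp only [lin, Prod.fst_add, Prod.snd_add]; push_cast; ring

/-- `lin` of the negative. [folklore] -/
theorem lin_neg (θ : K) (b : ℕ) (p : Row) : lin θ b (-p) = -lin θ b p := by
  simp only [lin, Prod.fst_neg, Prod.snd_neg]; push_cast; ring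

/-- `lin 0 = 0`. [folklore] -/
theorem lin_zero (θ : K) (b : ℕ) : lin θ b 0 = 0 := by
  simp [lin]

/-- **The product formula**: with `θ³ = ab²` (and `b ≠ 0`), `lin` is multiplicative for `mulRow`
(`θ² = bθ₂`, `θθ₂ = ab`, `θ₂² = aθ`). [cite: Cohen1993, §6.4.5] -/
theorem lin_mulRow (θ : K) {a b : ℕ} (hb : (b : K) ≠ 0) (hθ : θ ^ 3 = ((a * b ^ 2 : ℕ) : K)) (s t : Row) :
    lin θ b (mulRow a b s t) = lin θ b s * lin θ b t := by
  push_cast at hθ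
  have h1 : θ * θ = (b : K) * (θ ^ 2 / (b : K)) := by
    rw [mul_div_assoc', eq_div_iff hb]; ring
  have h2 : θ * (θ ^ 2 / (b : K)) = (a : K) * b := by
    rw [mul_div_assoc', div_eq_iff hb]; linear_combination hθ
  have h3 : (θ ^ 2 / (b : K)) * (θ ^ 2 / (b : K)) = (a : K) * θ := by
    rw [div_mul_div_comm, div_eq_iff (mul_ne_zero hb hb)]; linear_combination θ * hθ
  simp only [lin, mulRow]
  push_cast
  linear_combination (-((s.2.1 : K) * (t.2.1 : K))) * h1 + (-((s.2.1 : K) * (t.2.2 : K) + (s.2.2 : K) * (t.2.1 : K))) * h2 +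
    (-((s.2.2 : K) * (t.2.2 : K))) * h3

/-! ### Member sets -/

/-- **The member set of a six-entry code** is `(1/den) · lin (rowSpan (rowsOf c))`. [cite: Cohen1993, §4.7.1] -/
theorem mem_iff_rowSpan (θ : K) (b : ℕ) {c : ℕ × List ℤ} {h11 h12 h13 h22 h23 h33 : ℤ}
    (hc : c.2 = [h11, h12, h13, h22, h23, h33]) (φ : K) :
    Mem θ b c φ ↔ ∃ r ∈ rowSpan (rowsOf c), ((c.1 : ℕ) : K) * φ = lin θ b r := by
  rw [rowsOf_eq_of hc]
  constructor
  · rintro ⟨g11, g12, g13, g22, g23, g33, u, v, w, hc', e⟩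
    rw [hc] at hc'
    simp only [List.cons.injEq, and_true] at hc'
    obtain ⟨rfl, rfl, rfl, rfl, rfl, rfl⟩ := hc'
    refine ⟨(u * h11, u * h12 + v * h22, u * h13 + v * h23 + w * h33), mem_rowSpan_iff.2 ⟨u, v, w, ?_⟩, ?_⟩
    · simp
    · rw [e]; rfl
  · rintro ⟨r, hr, e⟩
    obtain ⟨u, v, w, rfl⟩ := mem_rowSpan_iff.1 hr
    refine ⟨h11, h12, h13, h22, h23, h33, u, v, w, hc, ?_⟩
    rw [e]
    simp only [lin, mul_zero, add_zero]

/-- **The member set of `latOfGens D gens`** is `(1/D) · lin (ℤ-span of gens)`. [cite: Cohen1993, §4.7.1] -/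
theorem mem_latOfGens_iff [CharZero K] (θ : K) (b : ℕ) {D : ℕ} (hD : 1 ≤ D) (gens : List Row) (φ : K) :
    Mem θ b (latOfGens D gens) φ ↔
      ∃ r ∈ AddSubgroup.closure {x | x ∈ gens}, ((D : ℕ) : K) * φ = lin θ b r := by
  have hg := tgcd_pos hD (hnf gens)
  have hgK : ((tgcd D (hnf gens) : ℕ) : K) ≠ 0 := by exact_mod_cast hg.ne'
  have hsplit := scale_rowsOf_codeOf (D := D) (isEch_hnf gens)
  have hDg : ((D / tgcd D (hnf gens) : ℕ) : K) * ((tgcd D (hnf gens) : ℕ) : K) = (D : K) := by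
    exact_mod_cast Nat.div_mul_cancel (Int.natCast_dvd_natCast.1 (tgcd_dvd D (hnf gens)).1)
  have hspan : ∀ x : Row, x ∈ rowSpan (hnf gens) ↔
      ∃ r' ∈ rowSpan (rowsOf (codeOf D (hnf gens))), x = scaleRow (tgcd D (hnf gens)) r' := by
    intro x
    conv_lhs => rw [hsplit]
    exact mem_rowSpan_scale_iff _ _ _
  rw [mem_iff_rowSpan θ b (c := latOfGens D gens) rfl, ← rowSpan_hnf]
  change (∃ r ∈ rowSpan (rowsOf (codeOf D (hnf gens))), ((D / tgcd D (hnf gens) : ℕ) : K) * φ = lin θ b r) ↔ _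
  constructor
  · rintro ⟨r, hr, e⟩
    refine ⟨scaleRow (tgcd D (hnf gens)) r, (hspan _).2 ⟨r, hr, rfl⟩, ?_⟩
    calc ((D : ℕ) : K) * φ
        = ((tgcd D (hnf gens) : ℕ) : K) * (((D / tgcd D (hnf gens) : ℕ) : K) * φ) := by rw [← hDg]; ring
      _ = lin θ b (scaleRow (tgcd D (hnf gens)) r) := by rw [e, lin_scaleRow, Int.cast_natCast]
  · rintro ⟨r', hr', e⟩
    obtain ⟨r, hr, rfl⟩ := (hspan _).1 hr'
    refine ⟨r, hr, mul_left_cancel₀ hgK ?_⟩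
    calc ((tgcd D (hnf gens) : ℕ) : K) * (((D / tgcd D (hnf gens) : ℕ) : K) * φ)
        = ((D : ℕ) : K) * φ := by rw [← hDg]; ring
      _ = ((tgcd D (hnf gens) : ℕ) : K) * lin θ b r := by rw [e, lin_scaleRow, Int.cast_natCast]

/-- The output of `latOfGens` has six entries. [folklore] -/
theorem latOfGens_snd (D : ℕ) (gens : List Row) : (latOfGens D gens).2 =
    [(hnf gens).1.1 / tgcd D (hnf gens), (hnf gens).1.2.1 / tgcd D (hnf gens), (hnf gens).1.2.2 / tgcd D (hnf gens),
      (hnf gens).2.1.2.1 / tgcd D (hnf gens), (hnf gens).2.1.2.2 / tgcd D (hnf gens),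
      (hnf gens).2.2.2.2 / tgcd D (hnf gens)] := rfl

/-! ### Element codes: product and norm -/

/-- **The product program is correct**: denominators multiply (so stay `≥ 1`) and values multiply.
[cite: Cohen1993, §6.4.5] -/
theorem mulE_spec (θ : K) {a b : ℕ} (hb : (b : K) ≠ 0) (hθ : θ ^ 3 = ((a * b ^ 2 : ℕ) : K)) :
    ∀ e₁ e₂ : Elem, 1 ≤ e₁.2.2.2 → 1 ≤ e₂.2.2.2 →
      1 ≤ (mulE ((a, b), (e₁, e₂))).2.2.2 ∧ val θ b (mulE ((a, b), (e₁, e₂))) = val θ b e₁ * val θ b e₂ := by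
  intro e₁ e₂ h₁ h₂
  refine ⟨Nat.mul_pos h₁ h₂, ?_⟩
  change lin θ b (mulRow a b (rowOfE e₁) (rowOfE e₂)) / (((e₁.2.2.2 * e₂.2.2.2 : ℕ)) : K) =
    lin θ b (rowOfE e₁) / ((e₁.2.2.2 : ℕ) : K) * (lin θ b (rowOfE e₂) / ((e₂.2.2.2 : ℕ) : K))
  rw [lin_mulRow θ hb hθ, div_mul_div_comm, Nat.cast_mul]

/-- **The norm program is correct**: `N((x + yθ + zθ₂)/den) = normRow (x, y, z) / den³`, given the
norm form on `ℚ`-coordinates. [cite: Cohen1993, §6.4.5] -/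
theorem normE_spec [CharZero K] (θ : K) {a b : ℕ}
    (hnorm : ∀ x y z : ℚ, Algebra.norm ℚ ((x : K) + (y : K) * θ + (z : K) * (θ ^ 2 / (b : K))) =
      x ^ 3 + (a * b ^ 2 : ℕ) * y ^ 3 + (a ^ 2 * b : ℕ) * z ^ 3 - 3 * (a * b : ℕ) * x * y * z) :
    ∀ e : Elem, 1 ≤ e.2.2.2 → 1 ≤ (normE ((a, b), e)).2 ∧
      (((normE ((a, b), e)).1 : ℤ) : ℚ) / (((normE ((a, b), e)).2 : ℕ) : ℚ) = Algebra.norm ℚ (val θ b e) := by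
  intro e he
  have hd : ((e.2.2.2 : ℕ) : ℚ) ≠ 0 := by exact_mod_cast (show e.2.2.2 ≠ 0 by omega)
  refine ⟨Nat.one_le_pow _ _ he, ?_⟩
  have hv : val θ b e = ((((e.1 : ℚ) / e.2.2.2 : ℚ)) : K) + ((((e.2.1 : ℚ) / e.2.2.2 : ℚ)) : K) * θ +
      ((((e.2.2.1 : ℚ) / e.2.2.2 : ℚ)) : K) * (θ ^ 2 / (b : K)) := by
    simp only [val]
    push_cast
    ring
  rw [hv, hnorm]
  simp only [normE, normRow, rowOfE]
  push_cast
  field_simp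

/-! ### Uniqueness of canonical codes -/

/-- **`lin` is injective on rows** when `(1, θ, θ₂)` is `ℚ`-independent. [folklore] -/
theorem lin_injective [CharZero K] (θ : K) (b : ℕ)
    (hind : ∀ c₀ c₁ c₂ : ℚ, (c₀ : K) + (c₁ : K) * θ + (c₂ : K) * (θ ^ 2 / (b : K)) = 0 → c₀ = 0 ∧ c₁ = 0 ∧ c₂ = 0)
    {r r' : Row} (h : lin θ b r = lin θ b r') : r = r' := by
  have h0 : lin θ b r - lin θ b r' = 0 := sub_eq_zero.2 h
  simp only [lin] at h0
  obtain ⟨e1, e2, e3⟩ := hind ((r.1 : ℚ) - r'.1) ((r.2.1 : ℚ) - r'.2.1) ((r.2.2 : ℚ) - r'.2.2) (by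
    push_cast
    linear_combination h0)
  refine Prod.ext ?_ (Prod.ext ?_ ?_)
  · exact_mod_cast sub_eq_zero.1 e1
  · exact_mod_cast sub_eq_zero.1 e2
  · exact_mod_cast sub_eq_zero.1 e3

/-- Basis rows are members: `lin r / den ∈ Mem c` for `r ∈ rowSpan (rowsOf c)`. [folklore] -/
theorem mem_of_mem_rowSpan [CharZero K] (θ : K) (b : ℕ) {c : ℕ × List ℤ} (hc : Canon c) {r : Row}
    (hr : r ∈ rowSpan (rowsOf c)) : Mem θ b c (lin θ b r / ((c.1 : ℕ) : K)) := by
  obtain ⟨h11, h12, h13, h22, h23, h33, hc2, -, -, -, -, -, -, -, -, -, hD, -⟩ := hc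
  have hDK : ((c.1 : ℕ) : K) ≠ 0 := by exact_mod_cast (show c.1 ≠ 0 by omega)
  exact (mem_iff_rowSpan θ b hc2 _).2 ⟨r, hr, mul_div_cancel₀ _ hDK⟩

/-- **Inclusion of member sets forces divisibility of denominators** (`den ∣ den'`): by the gcd
clause of `Canon`, `den` is the least denominator of its lattice. [cite: Cohen1993, §4.7.1] -/
theorem dvd_of_mem_imp [CharZero K] (θ : K) (b : ℕ)
    (hind : ∀ c₀ c₁ c₂ : ℚ, (c₀ : K) + (c₁ : K) * θ + (c₂ : K) * (θ ^ 2 / (b : K)) = 0 → c₀ = 0 ∧ c₁ = 0 ∧ c₂ = 0)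
    {c c' : ℕ × List ℤ} (hc : Canon c) (hc' : Canon c') (h : ∀ φ : K, Mem θ b c φ → Mem θ b c' φ) :
    c.1 ∣ c'.1 := by
  have hg := tgcd_eq_one_of_canon hc
  obtain ⟨g11, g12, g13, g22, g23, g33, hc2', -⟩ := id hc'
  obtain ⟨-, hD⟩ := isHNF_rowsOf_of_canon hc
  have hDK : ((c.1 : ℕ) : K) ≠ 0 := by exact_mod_cast (show c.1 ≠ 0 by omega)
  have key : ∀ r ∈ rowSpan (rowsOf c), ∃ r' : Row, scaleRow (c'.1 : ℤ) r = scaleRow (c.1 : ℤ) r' := by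
    intro r hr
    obtain ⟨r', -, e⟩ := (mem_iff_rowSpan θ b hc2' _).1 (h _ (mem_of_mem_rowSpan θ b hc hr))
    refine ⟨r', lin_injective θ b hind ?_⟩
    rw [lin_scaleRow, lin_scaleRow, Int.cast_natCast, Int.cast_natCast, ← e, mul_left_comm, mul_div_cancel₀ _ hDK]
  obtain ⟨r₁, e₁⟩ := key _ (mem_rowSpan_self _).1
  obtain ⟨r₂, e₂⟩ := key _ (mem_rowSpan_self _).2.1
  obtain ⟨r₃, e₃⟩ := key _ (mem_rowSpan_self _).2.2
  have hdiv := dvd_tgcd (k := (c.1 : ℤ)) (D := c'.1 * c.1)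
    (s := (scaleRow (c'.1 : ℤ) (rowsOf c).1, scaleRow (c'.1 : ℤ) (rowsOf c).2.1, scaleRow (c'.1 : ℤ) (rowsOf c).2.2))
    ⟨c'.1, by push_cast; ring⟩
    (Dvd.intro _ (congrArg Prod.fst e₁).symm) (Dvd.intro _ (congrArg (fun x => x.2.1) e₁).symm)
    (Dvd.intro _ (congrArg (fun x => x.2.2) e₁).symm) (Dvd.intro _ (congrArg (fun x => x.2.1) e₂).symm)
    (Dvd.intro _ (congrArg (fun x => x.2.2) e₂).symm) (Dvd.intro _ (congrArg (fun x => x.2.2) e₃).symm)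
  rw [tgcd_mul, hg, mul_one] at hdiv
  exact Int.natCast_dvd_natCast.1 hdiv

/-- **Inclusion of member sets with equal denominators forces inclusion of row spans.** [folklore] -/
theorem rowSpan_le_of_mem_imp [CharZero K] (θ : K) (b : ℕ)
    (hind : ∀ c₀ c₁ c₂ : ℚ, (c₀ : K) + (c₁ : K) * θ + (c₂ : K) * (θ ^ 2 / (b : K)) = 0 → c₀ = 0 ∧ c₁ = 0 ∧ c₂ = 0)
    {c c' : ℕ × List ℤ} (hc : Canon c) (hc' : Canon c') (h : ∀ φ : K, Mem θ b c φ → Mem θ b c' φ)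
    (hD : c.1 = c'.1) : rowSpan (rowsOf c) ≤ rowSpan (rowsOf c') := by
  intro r hr
  obtain ⟨g11, g12, g13, g22, g23, g33, hc2', -⟩ := id hc'
  obtain ⟨-, hD1⟩ := isHNF_rowsOf_of_canon hc
  have hDK : ((c.1 : ℕ) : K) ≠ 0 := by exact_mod_cast (show c.1 ≠ 0 by omega)
  obtain ⟨r', hr', e⟩ := (mem_iff_rowSpan θ b hc2' _).1 (h _ (mem_of_mem_rowSpan θ b hc hr))
  rw [← hD, mul_div_cancel₀ _ hDK] at e
  rwa [lin_injective θ b hind e]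

/-- **Canonical codes are unique**: canonical codes with the same member set coincide.
[cite: Cohen1993, §4.7.1 (uniqueness of the HNF representation)] -/
theorem canon_unique [CharZero K] (θ : K) (b : ℕ)
    (hind : ∀ c₀ c₁ c₂ : ℚ, (c₀ : K) + (c₁ : K) * θ + (c₂ : K) * (θ ^ 2 / (b : K)) = 0 → c₀ = 0 ∧ c₁ = 0 ∧ c₂ = 0) :
    ∀ c c' : ℕ × List ℤ, Canon c → Canon c' → (∀ φ : K, Mem θ b c φ ↔ Mem θ b c' φ) → c = c' := by
  intro c c' hc hc' h
  have hD : c.1 = c'.1 := Nat.dvd_antisymm (dvd_of_mem_imp θ b hind hc hc' fun φ => (h φ).1)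
    (dvd_of_mem_imp θ b hind hc' hc fun φ => (h φ).2)
  exact eq_of_canon hc hc' hD (le_antisymm (rowSpan_le_of_mem_imp θ b hind hc hc' (fun φ => (h φ).1) hD)
    (rowSpan_le_of_mem_imp θ b hind hc' hc (fun φ => (h φ).2) hD.symm))

end PureCubicCodes

end Literature.NumberTheory.CubicFields
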